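import Summits.ResolutionOfSingularities.ResolutionOfSingularities.Theorems.PurelyInseparableDim4Equivariance
import HarnessLib

/-!
# [OURS · res-dim4-pi] MODE 1h admits NO S₄-equivariant selection (q = 1, 2, 3): the non-equivariance of any
  implemented MODE-1h rule is intrinsic, not an engine artefact

Cell `res-dim4-pi` (D-0157 DOOR 2, wave 2), seat `res-dim4-p-6`; sequel of `PurelyInseparableDim4Equivariance`
(the RELATION `Step1h`, with all ties allowed, IS S₄-equivariant).  Desk WORD #25 (a) located the A-vs-B
discrepancy EN-0 in «MODE 1h's non-equivariant lex tie-break».  THIS FILE: no tie-break whatsoever can repair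
that — over every field and for every exponent `q ∈ {1, 2, 3}` there is NO `CentreRule` that is both
`IsEquivariantRule` and a selection of MODE-1h centres (`IsMode1hCentre`) wherever one exists
(`no_equivariant_mode1h_rule`).  Witness: the S₄-symmetric state `s₀ = (x₁x₂x₃x₄, r = 0, exc = ∅)`, whose
MODE-1h centres are exactly the coordinate subspaces of cardinality `q` (`isMode1hCentre_iff_card_eq`), none
of which is fixed by all transpositions.  (For `q = 4` the point is the unique centre and nothing is claimed;
sub-rules 1h2 / m1 pick the point at `s₀`, so `s₀` is no witness against them.)

Stated over the landed frame `PurelyInseparableDim4Target` / `…Rules` (`State`, `State.rename`,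
`IsPermissibleCentre`, `IsMode1hCentre`, `CentreRule`, `IsEquivariantRule`) and the tree's
`CentreBlowup.degIn / ordAlong_monomial`; the witness monomial is written inline (no definition).
[OURS · counted 0 · elementary · AI kernel work, weaker than expert review.]  A statement about OUR coordinate
frame; NOTHING here is a statement about resolution of singularities; resolution in dimension `≥ 4` /
characteristic `p > 0` is NOT proved by anything in this file.
bears_on: LADDER-RESOLUTION:D157-DOOR2 (res-dim4-pi · EQUIVARIANCE).  Host item (DR-157-C): `stmt-ResolutionOfSingularities-16155`.
-/

noncomputable section

set_option linter.dupNamespace false -- mandated namespace of this single-conjunct summit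

open MvPolynomial Finset

namespace Summit.ResolutionOfSingularities.ResolutionOfSingularities.Theorems.PIDim4

namespace Equivariance

open Literature.AlgebraicGeometry.Resolution
open Literature.AlgebraicGeometry.Resolution.CentreBlowup

variable {K : Type} [Field K]

/-! ## The symmetric witness `x^d`, `d = (1,1,1,1)` -/

/-- For an exponent with all entries `1`, `degIn S d = |S|`. [folklore] -/
theorem degIn_eq_card_of_forall_eq_one {d : Fin 4 →₀ ℕ} (hd : ∀ i, d i = 1) (S : Finset (Fin 4)) :
    degIn S d = S.card := by
  unfold degIn
  rw [Finset.card_eq_sum_ones]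
  exact Finset.sum_congr rfl fun i _ => hd i

/-- The permissible coordinate centres of `z^q + x^d` (`d = (1,1,1,1)`) are the non-empty `S` with `q ≤ |S|`.
[cite: HauserPerlega2019PRIMS, §2 (condition (1))] -/
theorem isPermissibleCentre_monomial_iff {d : Fin 4 →₀ ℕ} (hd : ∀ i, d i = 1) (q : ℕ) (S : Finset (Fin 4)) :
    IsPermissibleCentre q S (monomial d (1 : K)) ↔ S.Nonempty ∧ q ≤ S.card := by
  unfold IsPermissibleCentre
  rw [ordAlong_monomial S d one_ne_zero, degIn_eq_card_of_forall_eq_one hd, Nat.cast_le]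

/-- **The MODE-1h centres of `z^q + x₁x₂x₃x₄` are exactly the coordinate subspaces with `|S| = q`**
(`1 ≤ q ≤ 4`). [cite: HauserPerlega2019PRIMS, §2 (permissible blowups)] -/
theorem isMode1hCentre_monomial_iff {d : Fin 4 →₀ ℕ} (hd : ∀ i, d i = 1) {q : ℕ} (hq1 : 1 ≤ q) (hq4 : q ≤ 4)
    (S : Finset (Fin 4)) : IsMode1hCentre q S (monomial d (1 : K)) ↔ S.card = q := by
  unfold IsMode1hCentre
  simp only [isPermissibleCentre_monomial_iff hd]
  constructor
  · rintro ⟨⟨-, hqS⟩, hmin⟩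
    obtain ⟨T, -, hT⟩ := Finset.exists_subset_card_eq (s := (Finset.univ : Finset (Fin 4)))
      (n := q) (by rw [Finset.card_univ, Fintype.card_fin]; exact hq4)
    have hTne : T.Nonempty := Finset.card_pos.mp (by omega)
    have := hmin T ⟨hTne, hT.ge⟩
    omega
  · intro hS
    refine ⟨⟨Finset.card_pos.mp (by omega), hS.ge⟩, fun S' hS' => ?_⟩
    omega

/-- `x^d` with `d = (1,1,1,1)` is fixed by every renaming of the variables. [folklore] -/
theorem rename_monomial_of_forall_eq_one {d : Fin 4 →₀ ℕ} (hd : ∀ i, d i = 1) (e : Equiv.Perm (Fin 4)) :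
    rename e (monomial d (1 : K)) = monomial d 1 := by
  have h : d.mapDomain e = d := by
    ext i
    rw [Finsupp.mapDomain_equiv_apply, hd, hd]
  rw [rename_monomial, h]

/-- Hence the state `(x^d, 0, ∅)` is fixed by every renaming. [folklore] -/
theorem rename_witness {d : Fin 4 →₀ ℕ} (hd : ∀ i, d i = 1) (e : Equiv.Perm (Fin 4)) :
    State.rename e (⟨monomial d (1 : K), 0, ∅⟩ : State K) = ⟨monomial d 1, 0, ∅⟩ := by
  show (⟨rename e (monomial d (1 : K)), (0 : Fin 4 →₀ ℕ).mapDomain e, (∅ : Finset (Fin 4)).map e.toEmbedding⟩ :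
      State K) = ⟨monomial d 1, 0, ∅⟩
  rw [rename_monomial_of_forall_eq_one hd, Finsupp.mapDomain_zero, Finset.map_empty]

/-- A subset of the four variables with `1 ≤ |S| ≤ 3` is moved by some transposition. [folklore] -/
theorem exists_swap_map_ne {S : Finset (Fin 4)} (h1 : 1 ≤ S.card) (h3 : S.card ≤ 3) :
    ∃ i k : Fin 4, S.map (Equiv.swap i k).toEmbedding ≠ S := by
  obtain ⟨i, hi⟩ : S.Nonempty := Finset.card_pos.mp (by omega)
  obtain ⟨k, hk⟩ : ∃ k, k ∉ S := by
    by_contra h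
    push Not at h
    have : S = Finset.univ := Finset.eq_univ_iff_forall.mpr h
    rw [this, Finset.card_univ, Fintype.card_fin] at h3
    omega
  refine ⟨i, k, fun h => hk ?_⟩
  rw [← h, Finset.mem_map_equiv, Equiv.symm_swap, Equiv.swap_apply_right]
  exact hi

/-! ## The obstruction -/

/-- **NO S₄-EQUIVARIANT MODE-1h RULE** (`q = 1, 2, 3`, every field): there is no centre rule that renames
with the variables (`IsEquivariantRule`) and picks a MODE-1h centre wherever one exists.  At the
S₄-symmetric state `s₀ = (x₁x₂x₃x₄, 0, ∅)` an equivariant rule's centre would be an S₄-invariant subset of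
cardinality `q`, and there is none.  So the relation `Step1h` is equivariant (`Equivariance.step1h_rename`)
but none of its selections is — the EN-0 cause «non-equivariant tie-break» (desk WORD #25 (a)) is intrinsic
to MODE 1h as a RULE. [folklore] -/
theorem no_equivariant_mode1h_rule {q : ℕ} (hq1 : 1 ≤ q) (hq3 : q ≤ 3) :
    ¬ ∃ R : CentreRule K, IsEquivariantRule R ∧
        ∀ s : State K, (∃ S, IsMode1hCentre q S s.F) → IsMode1hCentre q (R s) s.F := by
  rintro ⟨R, hRe, hR1h⟩
  set d : Fin 4 →₀ ℕ := Finsupp.equivFunOnFinite.symm fun _ => 1 with hd_def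
  have hd : ∀ i, d i = 1 := fun i => rfl
  set s₀ : State K := ⟨monomial d 1, 0, ∅⟩ with hs₀
  -- some MODE-1h centre exists at `s₀` (any `q`-subset), so `R s₀` is one: `|R s₀| = q`
  obtain ⟨T, -, hT⟩ := Finset.exists_subset_card_eq (s := (Finset.univ : Finset (Fin 4)))
    (n := q) (by rw [Finset.card_univ, Fintype.card_fin]; omega)
  have hex : ∃ S, IsMode1hCentre q S s₀.F := ⟨T, (isMode1hCentre_monomial_iff hd hq1 (by omega) T).mpr hT⟩
  have hcard : (R s₀).card = q := (isMode1hCentre_monomial_iff hd hq1 (by omega) (R s₀)).mp (hR1h s₀ hex)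
  -- a transposition moving `R s₀`, against equivariance at the fixed state `s₀`
  obtain ⟨i, k, hne⟩ := exists_swap_map_ne (S := R s₀) (by omega) (by omega)
  have h := hRe (Equiv.swap i k) s₀
  rw [show State.rename (Equiv.swap i k) s₀ = s₀ from rename_witness hd _] at h
  exact hne h.symm

/-- In particular at the exponent of record `q = p = 2`: no equivariant MODE-1h rule over any field. [folklore] -/
theorem no_equivariant_mode1h_rule_two :
    ¬ ∃ R : CentreRule K, IsEquivariantRule R ∧
        ∀ s : State K, (∃ S, IsMode1hCentre 2 S s.F) → IsMode1hCentre 2 (R s) s.F :=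
  no_equivariant_mode1h_rule (by norm_num) (by norm_num)

end Equivariance

end Summit.ResolutionOfSingularities.ResolutionOfSingularities.Theorems.PIDim4

end
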